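import Summits.Ventures.LatticeQCDFlow.Exactness.ReversibleKernelParityDecomposition
import Literature.Probability.MarkovChains.MixtureProposalPeskun
import Literature.Probability.MarkovChains.IndependenceSamplerSpectralGap
import HarnessLib

/-!
# Finite state space, NO summability: the independence sampler with the SYMMETRISED proposal `q̄ = ½(q + q∘σ)` never has larger Kemeny–Snell asymptotic variance than the sampler with proposal `q`, for every observable of a definite parity — `v(f, π, MH(q̄)) ≤ v(f, π, MH(q))`

HONEST FRAMING: exact (Metropolis-corrected) sampling algorithms for lattice gauge theory;
figures of merit are autocorrelation/cost numbers at stated couplings and volumes; no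
continuum-physics claim.  (SCALAR calibration rung S0-A: not a gauge result.)

Venture `LatticeQCDFlow` (cell pub-lqcd), topic `Exactness`; FANOUT row 2 (`s0-phi4`).  NEW WORK of the
cell — the finite-state counterpart (no summability hypotheses, everything a matrix inverse) of gen-22's
`FlowSamplerSymmetrisationDirichlet.symmetrised_tauInt_le_of_parity`, in the vocabulary of
`Literature.Probability.MarkovChains` (`mhKernel`, `asympVar`, `dirichletForm`, `fundamentalMatrix`,
the variational formula `variational_le` / `variational_eq`, Liu 2001 Thm 13.3.4 `…_dirichletForm`).
Data: `π > 0` (`Σ π = 1`) invariant under an involutive permutation `σ`; a positive normalised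
independence proposal `q`; `q̄ y = ½(q y + q (σ y))`.

* `imh_conj_eq` — `MH(q∘σ)(x, y) = MH(q)(σx, σy)` (`π ∘ σ = π`); `dirichletForm_conj` —
  hence `𝓔_{MH(q∘σ)}(u) = 𝓔_{MH(q)}(u ∘ σ)` for involutive `σ`;
* `dirichletForm_two_mix` — `𝓔` is affine in the kernel: `𝓔_{½A+½B} = ½𝓔_A + ½𝓔_B`;
* `dirichletForm_symmetrised_ge_of_parity` — for `u ∘ σ = c·u` (`c² = 1`):
  `𝓔_{MH(q̄)}(u) ≥ 𝓔_{MH(q)}(u)` (Liu/Tierney: `𝓔_{MH(q̄)} ≥ ½𝓔_{MH(q)} + ½𝓔_{MH(q∘σ)}`, and the two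
  halves agree on parity-homogeneous `u`);
* **`imh_symmetrised_asympVar_le_of_parity`** — THE THEOREM: `f ∘ σ = c·f`, `c² = 1` ⇒
  `v(f, π, MH(q̄)) ≤ v(f, π, MH(q))` (the symmetrised kernel is `σ`-equivariant, so `Z_s f̄` has the parity
  of `f̄` — `ReversibleKernelParityDecomposition` — and the variational supremum for `MH(q̄)` is attained
  inside the sector, where its Dirichlet form dominates `MH(q)`'s).

With `ReversibleKernelParityDecomposition.mh_asympVar_parity_split` (`v = v₊ + v₋` under `MH(q̄)`) this is
the complete finite-state picture behind the mixed-parity witness `FlowSamplerSymmetrisationMixedParityPeskun`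
(`10/9 < 14/9` for a mixed `f`; sector by sector the symmetrised sampler is never worse).  Nothing is
cited as a fact; the Literature files carry their citations.

NOT CLAIMED: mixed-parity observables (false in general: the witness); general state spaces (gen-22's
file); any value for any run.
-/

namespace Summit.Ventures.LatticeQCDFlow.Exactness

open Finset Matrix Literature.Probability.MarkovChains

variable {X : Type*} [Fintype X] [DecidableEq X]

/-! ## §1 Conjugating the proposal by `σ` conjugates the kernel -/

/-- `MH(q ∘ σ)(x, y) = MH(q)(σ x, σ y)` for `π ∘ σ = π`. -/
theorem imh_conj_eq {π q : X → ℝ} {σ : Equiv.Perm X} (hπ : ∀ x, π (σ x) = π x) (x y : X) :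
    mhKernel (fun _ z => q (σ z)) π x y = mhKernel (fun _ z => q z) π (σ x) (σ y) := by
  have hrate : ∀ a b, mhRate (fun _ z => q (σ z)) π a b = mhRate (fun _ z => q z) π (σ a) (σ b) :=
    fun a b => by unfold mhRate; rw [hπ, hπ]
  by_cases h : y = x
  · subst h
    rw [mhKernel_self, mhKernel_self]
    congr 1
    rw [Finset.sum_erase_eq_sub (Finset.mem_univ _), Finset.sum_erase_eq_sub (Finset.mem_univ _), hrate]
    congr 1
    rw [← Equiv.sum_comp σ (fun z => mhRate (fun _ z => q z) π (σ y) z)]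
    exact Finset.sum_congr rfl fun z _ => hrate y z
  · have h' : σ y ≠ σ x := fun e => h (σ.injective e)
    rw [mhKernel_of_ne h', mhKernel_of_ne h, hrate]

omit [DecidableEq X] in
/-- Reindexing a Dirichlet form along an involutive `σ` with `π ∘ σ = π`:
if `P' x y = P (σ x) (σ y)` then `𝓔_{P'}(u) = 𝓔_P(u ∘ σ)`. -/
theorem dirichletForm_conj {π : X → ℝ} {P P' : Matrix X X ℝ} {σ : Equiv.Perm X}
    (hσσ : ∀ x, σ (σ x) = x) (hπ : ∀ x, π (σ x) = π x) (hP' : ∀ x y, P' x y = P (σ x) (σ y))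
    (u : X → ℝ) : dirichletForm π P' u = dirichletForm π P (fun x => u (σ x)) := by
  unfold dirichletForm
  congr 1
  rw [← Equiv.sum_comp σ (fun x => ∑ y, π x * P x y * (u (σ x) - u (σ y)) ^ 2)]
  refine Finset.sum_congr rfl fun x _ => ?_
  rw [← Equiv.sum_comp σ (fun y => π (σ x) * P (σ x) y * (u (σ (σ x)) - u (σ y)) ^ 2)]
  refine Finset.sum_congr rfl fun y _ => ?_
  rw [hP', hπ, hσσ, hσσ]

omit [DecidableEq X] in
/-- The Dirichlet form is affine in the kernel: `𝓔_{aA + bB}(u) = a𝓔_A(u) + b𝓔_B(u)`. -/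
theorem dirichletForm_two_mix (π : X → ℝ) (A B : Matrix X X ℝ) (a b : ℝ) (u : X → ℝ) :
    dirichletForm π (fun x y => a * A x y + b * B x y) u = a * dirichletForm π A u + b * dirichletForm π B u := by
  unfold dirichletForm
  have e : ∀ x y, π x * (a * A x y + b * B x y) * (u x - u y) ^ 2
      = a * (π x * A x y * (u x - u y) ^ 2) + b * (π x * B x y * (u x - u y) ^ 2) := fun x y => by ring
  simp only [e, Finset.sum_add_distrib, ← Finset.mul_sum]
  ring

/-! ## §2 The symmetrised sampler's Dirichlet form dominates on each parity sector -/

/-- **`𝓔_{MH(q̄)}(u) ≥ 𝓔_{MH(q)}(u)` for parity-homogeneous `u`** (`u ∘ σ = c·u`, `c² = 1`, `σ`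
involutive, `π ∘ σ = π`, `π > 0`). -/
theorem dirichletForm_symmetrised_ge_of_parity {π q : X → ℝ} (hπ0 : ∀ x, 0 < π x)
    {σ : Equiv.Perm X} (hσσ : ∀ x, σ (σ x) = x) (hπ : ∀ x, π (σ x) = π x)
    {u : X → ℝ} {c : ℝ} (hc : c ^ 2 = 1) (hu : ∀ x, u (σ x) = c * u x) :
    dirichletForm π (mhKernel (fun _ z => q z) π) u
      ≤ dirichletForm π (mhKernel (fun _ z => (q z + q (σ z)) / 2) π) u := by
  -- Liu/Tierney with the two proposals `q`, `q ∘ σ` and weights `½, ½`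
  have hL := Liu2001_thm_13_3_4_dirichletForm (X := X) (ι := Fin 2) (π := π)
    (α := ![1 / 2, 1 / 2]) (T := ![fun _ z => q z, fun _ z => q (σ z)]) hπ0
    (fun i => by fin_cases i <;> simp) u
  have emix : mixtureProposal (![1 / 2, 1 / 2] : Fin 2 → ℝ)
      (![fun _ z => q z, fun _ z => q (σ z)] : Fin 2 → X → X → ℝ)
      = fun _ z => (q z + q (σ z)) / 2 := by
    funext x z
    simp [mixtureProposal, Fin.sum_univ_two]
    ring
  have ealt : mhMixture (![1 / 2, 1 / 2] : Fin 2 → ℝ)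
      (![fun _ z => q z, fun _ z => q (σ z)] : Fin 2 → X → X → ℝ) π
      = fun x y => (1 / 2) * mhKernel (fun _ z => q z) π x y
          + (1 / 2) * mhKernel (fun _ z => q (σ z)) π x y := by
    funext x y
    simp [mhMixture, Fin.sum_univ_two]
  rw [emix, ealt, dirichletForm_two_mix] at hL
  -- the conjugated half equals the plain one on parity-homogeneous `u`
  have hconj : dirichletForm π (mhKernel (fun _ z => q (σ z)) π) u
      = dirichletForm π (mhKernel (fun _ z => q z) π) u := by
    rw [dirichletForm_conj (P := mhKernel (fun _ z => q z) π) hσσ hπ (fun x y => imh_conj_eq hπ x y) u]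
    have e : (fun x => u (σ x)) = fun x => c * u x := funext hu
    rw [e]
    unfold dirichletForm
    congr 1
    refine Finset.sum_congr rfl fun x _ => Finset.sum_congr rfl fun y _ => ?_
    have : (c * u x - c * u y) ^ 2 = c ^ 2 * (u x - u y) ^ 2 := by ring
    rw [this, hc, one_mul]
  rw [hconj] at hL
  linarith

/-! ## §3 The theorem -/

omit [DecidableEq X] in
/-- The symmetrised density is positive and normalised. -/
theorem finSymmetrisedDensity_facts {q : X → ℝ} (hq0 : ∀ x, 0 < q x) (hq1 : ∑ x, q x = 1)
    (σ : Equiv.Perm X) :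
    (∀ z, 0 < (q z + q (σ z)) / 2) ∧ ∑ z, (q z + q (σ z)) / 2 = 1 := by
  refine ⟨fun z => by have := hq0 z; have := hq0 (σ z); positivity, ?_⟩
  have h : ∑ z, q (σ z) = ∑ z, q z := Equiv.sum_comp σ q
  rw [← Finset.sum_div, Finset.sum_add_distrib, h, hq1]
  norm_num

/-- **THE SYMMETRISED INDEPENDENCE SAMPLER IS NEVER WORSE ON A PARITY SECTOR (finite state, no
summability).**  `π > 0`, `Σ π = 1`, `π ∘ σ = π`, `σ` involutive; `q > 0`, `Σ q = 1`;
`f ∘ σ = c·f` with `c² = 1`.  Then `v(f, π, MH(q̄)) ≤ v(f, π, MH(q))`, `q̄ = ½(q + q∘σ)`. -/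
theorem imh_symmetrised_asympVar_le_of_parity {π q : X → ℝ} (hπ0 : ∀ x, 0 < π x)
    (hπ1 : ∑ x, π x = 1) (hq0 : ∀ x, 0 < q x) (hq1 : ∑ x, q x = 1)
    {σ : Equiv.Perm X} (hσσ : ∀ x, σ (σ x) = x) (hπ : ∀ x, π (σ x) = π x)
    {f : X → ℝ} {c : ℝ} (hc : c ^ 2 = 1) (hf : ∀ x, f (σ x) = c * f x) :
    asympVar f π (mhKernel (fun _ z => (q z + q (σ z)) / 2) π)
      ≤ asympVar f π (mhKernel (fun _ z => q z) π) := by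
  obtain ⟨hs0, hs1⟩ := finSymmetrisedDensity_facts hq0 hq1 σ
  have hP : IsRowStochastic (mhKernel (fun _ z => q z) π : Matrix X X ℝ) := imh_isRowStochastic hπ0 hq0 hq1
  have hPs : IsRowStochastic (mhKernel (fun _ z => (q z + q (σ z)) / 2) π : Matrix X X ℝ) :=
    imh_isRowStochastic hπ0 hs0 hs1
  have hst : IsStationary π (mhKernel (fun _ z => q z) π : Matrix X X ℝ) := mhKernel_isStationary hπ0 _
  have hsts : IsStationary π (mhKernel (fun _ z => (q z + q (σ z)) / 2) π : Matrix X X ℝ) :=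
    mhKernel_isStationary hπ0 _
  have hK := isUnit_fundamentalInv hπ1 hP hst (imh_isIrreducible hπ0 hq0 hq1)
  have hKs := isUnit_fundamentalInv hπ1 hPs hsts (imh_isIrreducible hπ0 hs0 hs1)
  rw [asympVar_eq_centred hπ1 hPs hsts hKs f, asympVar_eq_centred hπ1 hP hst hK f]
  set g := centred π f with hgdef
  have hg : ∑ y, π y * g y = 0 := sum_mul_centred hπ1 f
  -- `g` has parity `c` (the mean `m` satisfies `m = c·m`)
  have hm : ∑ y, π y * f y = c * ∑ y, π y * f y := by
    calc ∑ y, π y * f y = ∑ y, π (σ y) * f (σ y) := (Equiv.sum_comp σ (fun y => π y * f y)).symm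
      _ = ∑ y, c * (π y * f y) := Finset.sum_congr rfl fun y _ => by rw [hπ, hf]; ring
      _ = c * ∑ y, π y * f y := by rw [Finset.mul_sum]
  have hgpar : ∀ x, g (σ x) = c * g x := fun x => by
    simp only [hgdef, centred]
    rw [hf]
    linarith [hm]
  -- the symmetrised kernel is `σ`-equivariant, so `Z_s g` has parity `c`
  have hPsσ : ∀ x y, (mhKernel (fun _ z => (q z + q (σ z)) / 2) π : Matrix X X ℝ) (σ x) (σ y)
      = (mhKernel (fun _ z => (q z + q (σ z)) / 2) π : Matrix X X ℝ) x y :=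
    fun x y => mhKernel_equivariant (T := fun _ z => (q z + q (σ z)) / 2)
      (fun a b => by show (q (σ b) + q (σ (σ b))) / 2 = (q b + q (σ b)) / 2; rw [hσσ, add_comm]) hπ x y
  have hu : ∀ x, (fundamentalMatrix π (mhKernel (fun _ z => (q z + q (σ z)) / 2) π) *ᵥ g) (σ x)
      = c * (fundamentalMatrix π (mhKernel (fun _ z => (q z + q (σ z)) / 2) π) *ᵥ g) x :=
    fundamentalMatrix_mulVec_parity hπ hPsσ hKs hgpar
  -- variational formula: attained for the symmetrised kernel inside the sector, bounded for the raw one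
  have h1 := variational_eq hπ1 hPs hsts hKs hg
  have h2 := variational_le hπ0 hπ1 hP (mhKernel_detailedBalance hπ0 _) hK hg
    (fundamentalMatrix π (mhKernel (fun _ z => (q z + q (σ z)) / 2) π) *ᵥ g)
  have h3 := dirichletForm_symmetrised_ge_of_parity (q := q) hπ0 hσσ hπ hc hu
  linarith

end Summit.Ventures.LatticeQCDFlow.Exactness
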